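import Mathlib
import Literature.Computability.AlgebraicComplexity.ST21TruncatedFormulaComplexity
import Summits.ValiantsHypothesis.ValiantsHypothesis.Theorems.BarrierLeverPartitionMinorsHitByVPProductStates

/-!
# Route BarrierLever — item `PartitionMinorsHitByVP` (stmt-ValiantsHypothesis-19717):
# the SUBSET-SUM VANDERMONDE witness — coefficient identity

Helper file (`--supports stmt-ValiantsHypothesis-19717`; cell valiant-natproofs, rung V4, 𝒟-side of
door (c); prover seat val-np-p3 gen 4). Definition-free, cone-free (imports `Mathlib`, the Literature
truncation toolkit and the cell's `…ProductStates` exponent bookkeeping). Closes NO item. Part 2 of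
the subset-sum witness (memo `HOME/val-np-p3/g4/evidence-subsetsum-witness-valnp3-g4.md`).

In `MvPolynomial (Fin (h+h)) ℂ` write `x_a = X (castAdd h a)`, `y_c = X (natAdd h c)`. For a table
`Γ : Option (Fin h) → Fin h → ℂ` (row `none` is the shift `Γ₀`) put
`G_o = ∏_c (1 + Γ o c · y_c)` and `F_Γ = G_none · ∏_a (1 + x_a · G_{some a})` (written out below).

* `coeff_indicator_prod_one_add` — GENERAL: the coefficient of a square-free monomial `∏_{x∈W'} X_x`
  in a product `∏_{p ∈ I} (1 + γ_p X_{v p})` of affine one-variable factors is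
  `∏_{x ∈ W'} Σ_{p ∈ I, v p = x} γ_p` (choose, for every `x ∈ W'`, the factor supplying `X_x`).
* **`coeff_partition_subsetSumF`** — `coeff_{x^U y^W} F_Γ = ∏_{c ∈ W} (Γ none c + Σ_{a ∈ U} Γ (some a) c)`:
  the layout matrix of item 19717 at `F_Γ` is the GENERALIZED VANDERMONDE `(Q_{u_i}^{w_j})`, the
  monomials `z^{w_j}` evaluated at the subset sums `Q_U = Γ₀ + Σ_{a∈U} Γ_a` — an affine image of the
  `0/1` points `1_{u_i}`.
* `coeff_partition_trunc_subsetSumF` — the same for the degree-`≤ 2h` truncation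
  `Σ_{e ≤ 2h} F_Γ^{(e)}` (the partition exponent has degree `#U + #W ≤ 2h`), which is the actual
  witness (its size and degree are bounded in the companion file `…SubsetSumWitnessSmall`).

`F_Γ` is read-once in `x` but DENSE in `y` (each `G_o` involves every `y_c`): it is neither a product
state nor a Chow product, and its row capacity is unbounded — it is the witness proposed for the
capacity-barrier layouts (companion `…SubsetSumRecursiveSplits`: recursive even splits ⇒ nonsingular).

WHAT THIS IS NOT: nothing on item 19717 itself, crux 14610 or `VP ≠ VNP`.
-/

set_option linter.dupNamespace false

open Finset MvPolynomial

namespace Summit.ValiantsHypothesis.ValiantsHypothesis.Theorems.BarrierLever.SubsetSum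

open Summit.ValiantsHypothesis.ValiantsHypothesis.Theorems.BarrierLever.ProductStateSums
  (castAdd_ne_natAdd partitionExpo_apply_castAdd partitionExpo_apply_natAdd)

noncomputable section

/-! ## 1. Square-free coefficients of a product of affine one-variable factors -/

/-- The indicator exponent `Σ_{x ∈ W'} e_x` takes the value `[x ∈ W']`. -/
theorem indicator_apply {σ : Type*} [DecidableEq σ] (W' : Finset σ) (x : σ) :
    (∑ x' ∈ W', Finsupp.single x' 1 : σ →₀ ℕ) x = if x ∈ W' then 1 else 0 := by
  rw [Finsupp.finsetSum_apply]
  simp only [Finsupp.single_apply]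
  rw [Finset.sum_ite_eq' W' x]

/-- Removing a point from the indicator exponent. -/
theorem indicator_sub_single {σ : Type*} [DecidableEq σ] (W' : Finset σ) {x₀ : σ} (hx₀ : x₀ ∈ W') :
    (∑ x' ∈ W', Finsupp.single x' 1 : σ →₀ ℕ) - Finsupp.single x₀ 1 =
      ∑ x' ∈ W'.erase x₀, Finsupp.single x' 1 := by
  ext x
  rw [Finsupp.tsub_apply, indicator_apply, indicator_apply, Finsupp.single_apply]
  by_cases hx : x = x₀
  · subst hx; simp [hx₀]
  · simp [Finset.mem_erase, hx, Ne.symm hx]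

/-- **Square-free coefficients of `∏_{p ∈ I} (1 + γ_p X_{v p})`.** For every finite set `W'` of
variables, `coeff_{∏_{x∈W'} X_x} ∏_{p∈I} (1 + γ_p X_{v p}) = ∏_{x∈W'} Σ_{p ∈ I, v p = x} γ_p`. -/
theorem coeff_indicator_prod_one_add {σ π R : Type*} [CommSemiring R] [DecidableEq σ] [DecidableEq π]
    (I : Finset π) (v : π → σ) (γ : π → R) (W' : Finset σ) :
    coeff (∑ x ∈ W', Finsupp.single x 1) (∏ p ∈ I, (1 + C (γ p) * X (v p)) : MvPolynomial σ R) =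
      ∏ x ∈ W', ∑ p ∈ I.filter (fun p => v p = x), γ p := by
  induction I using Finset.induction_on generalizing W' with
  | empty =>
    rw [Finset.prod_empty, coeff_one]
    by_cases hW : W' = ∅
    · subst hW; simp
    · obtain ⟨x, hx⟩ := Finset.nonempty_iff_ne_empty.2 hW
      rw [Finset.prod_eq_zero hx (by simp)]
      rw [if_neg]
      intro h0
      have := congrArg (fun m : σ →₀ ℕ => m x) h0
      simp only [Finsupp.coe_zero, Pi.zero_apply, indicator_apply, if_pos hx] at this
      exact zero_ne_one this
  | insert p₀ I' hp₀ ih =>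
    rw [Finset.prod_insert hp₀, add_mul, one_mul, coeff_add, mul_assoc, coeff_C_mul, coeff_X_mul',
      ih W']
    have hsupp : (v p₀ ∈ (∑ x ∈ W', Finsupp.single x 1 : σ →₀ ℕ).support) ↔ v p₀ ∈ W' := by
      rw [Finsupp.mem_support_iff, indicator_apply]
      by_cases h : v p₀ ∈ W' <;> simp [h]
    by_cases hx₀ : v p₀ ∈ W'
    · rw [if_pos (hsupp.2 hx₀), indicator_sub_single W' hx₀, ih (W'.erase (v p₀))]
      -- RHS: split off the factor `x = v p₀`
      rw [← Finset.mul_prod_erase W' (fun x => ∑ p ∈ I'.filter (fun p => v p = x), γ p) hx₀,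
        ← Finset.mul_prod_erase W' (fun x => ∑ p ∈ (insert p₀ I').filter (fun p => v p = x), γ p) hx₀]
      have hrest : ∀ x ∈ W'.erase (v p₀), (∑ p ∈ (insert p₀ I').filter (fun p => v p = x), γ p) =
          ∑ p ∈ I'.filter (fun p => v p = x), γ p := by
        intro x hx
        rw [Finset.filter_insert, if_neg (fun h => (Finset.mem_erase.1 hx).1 h.symm)]
      rw [Finset.prod_congr rfl hrest, Finset.filter_insert, if_pos rfl, Finset.sum_insert (by
        intro h; exact hp₀ (Finset.mem_filter.1 h).1)]
      ring
    · rw [if_neg (fun h => hx₀ (hsupp.1 h)), mul_zero, add_zero]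
      refine Finset.prod_congr rfl fun x hx => ?_
      rw [Finset.filter_insert, if_neg (fun h0 : v p₀ = x => hx₀ (h0 ▸ hx))]

/-! ## 2. The partition coefficients of `F_Γ` -/

variable {h : ℕ}

/-- Every index of `Fin (h + h)` is an `x`-index `castAdd a` or a `y`-index `natAdd c`. -/
theorem castAdd_or_natAdd (s : Fin (h + h)) :
    (∃ a : Fin h, Fin.castAdd h a = s) ∨ (∃ c : Fin h, Fin.natAdd h c = s) := by
  obtain ⟨x, rfl⟩ := finSumFinEquiv.surjective s
  rcases x with a | c
  · exact Or.inl ⟨a, by simp⟩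
  · exact Or.inr ⟨c, by simp⟩

/-- `∏_{a ∈ V} x_a` is the monomial of the partition exponent `x^V y^∅`. -/
theorem prod_X_castAdd_eq_monomial (V : Finset (Fin h)) :
    (∏ a ∈ V, X (Fin.castAdd h a) : MvPolynomial (Fin (h + h)) ℂ) =
      monomial (∑ a ∈ V, Finsupp.single (Fin.castAdd h a) 1 +
        ∑ c ∈ (∅ : Finset (Fin h)), Finsupp.single (Fin.natAdd h c) 1) 1 := by
  rw [Finset.sum_empty, add_zero]
  induction V using Finset.induction_on with
  | empty => simp
  | insert a V ha ih =>
    rw [Finset.prod_insert ha, Finset.sum_insert ha, ih, X, monomial_mul, one_mul]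

/-- The partition exponent `x^V y^∅` is below `x^U y^W` iff `V ⊆ U`. -/
theorem partitionExpo_le_iff (V U W : Finset (Fin h)) :
    ((∑ a ∈ V, Finsupp.single (Fin.castAdd h a) 1 +
        ∑ c ∈ (∅ : Finset (Fin h)), Finsupp.single (Fin.natAdd h c) 1 : Fin (h + h) →₀ ℕ) ≤
      ∑ a ∈ U, Finsupp.single (Fin.castAdd h a) 1 + ∑ c ∈ W, Finsupp.single (Fin.natAdd h c) 1)
    ↔ V ⊆ U := by
  constructor
  · intro hle a haV
    have h1 := hle (Fin.castAdd h a)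
    simp only [Finsupp.coe_add, Pi.add_apply] at h1
    rw [← Finsupp.add_apply, ← Finsupp.add_apply, partitionExpo_apply_castAdd,
      partitionExpo_apply_castAdd, if_pos haV] at h1
    by_contra haU
    rw [if_neg haU] at h1
    exact Nat.not_succ_le_zero 0 h1
  · intro hVU s
    obtain ⟨a, rfl⟩ | ⟨c, rfl⟩ := castAdd_or_natAdd s
    · rw [partitionExpo_apply_castAdd, partitionExpo_apply_castAdd]
      by_cases haV : a ∈ V
      · rw [if_pos haV, if_pos (hVU haV)]
      · rw [if_neg haV]; exact Nat.zero_le _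
    · rw [partitionExpo_apply_natAdd, partitionExpo_apply_natAdd]
      simp

/-- For `V ⊆ U`, `x^U y^W - x^V = ` the indicator exponent of `castAdd(U ∖ V) ∪ natAdd(W)`. -/
theorem partitionExpo_sub (V U W : Finset (Fin h)) (hVU : V ⊆ U) :
    ((∑ a ∈ U, Finsupp.single (Fin.castAdd h a) 1 + ∑ c ∈ W, Finsupp.single (Fin.natAdd h c) 1 :
        Fin (h + h) →₀ ℕ) -
      (∑ a ∈ V, Finsupp.single (Fin.castAdd h a) 1 +
        ∑ c ∈ (∅ : Finset (Fin h)), Finsupp.single (Fin.natAdd h c) 1)) =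
      ∑ x ∈ (U \ V).map (Fin.castAddEmb h) ∪ W.map (Fin.natAddEmb h), Finsupp.single x 1 := by
  ext s
  rw [Finsupp.tsub_apply, indicator_apply]
  obtain ⟨a, rfl⟩ | ⟨c, rfl⟩ := castAdd_or_natAdd s
  · rw [partitionExpo_apply_castAdd, partitionExpo_apply_castAdd]
    have hmem : (Fin.castAdd h a ∈ (U \ V).map (Fin.castAddEmb h) ∪ W.map (Fin.natAddEmb h)) ↔
        a ∈ U \ V := by
      rw [Finset.mem_union]
      constructor
      · rintro (h1 | h2)
        · obtain ⟨a', ha', hh⟩ := Finset.mem_map.1 h1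
          rw [Fin.castAddEmb_apply, Fin.castAdd_inj] at hh
          exact hh ▸ ha'
        · obtain ⟨c, -, hc⟩ := Finset.mem_map.1 h2
          exact absurd hc.symm (castAdd_ne_natAdd a c)
      · intro ha
        exact Or.inl (Finset.mem_map.2 ⟨a, ha, rfl⟩)
    simp only [hmem, Finset.mem_sdiff]
    by_cases haV : a ∈ V
    · rw [if_pos (hVU haV), if_pos haV]; simp [haV]
    · rw [if_neg haV]
      by_cases haU : a ∈ U <;> simp [haU, haV]
  · rw [partitionExpo_apply_natAdd, partitionExpo_apply_natAdd]
    have hmem : (Fin.natAdd h c ∈ (U \ V).map (Fin.castAddEmb h) ∪ W.map (Fin.natAddEmb h)) ↔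
        c ∈ W := by
      rw [Finset.mem_union]
      constructor
      · rintro (h1 | h2)
        · obtain ⟨a, -, ha⟩ := Finset.mem_map.1 h1
          exact absurd ha (castAdd_ne_natAdd a c)
        · obtain ⟨c', hc', hh⟩ := Finset.mem_map.1 h2
          rw [Fin.natAddEmb_apply, Fin.natAdd_inj] at hh
          exact hh ▸ hc'
      · intro hc
        exact Or.inr (Finset.mem_map.2 ⟨c, hc, rfl⟩)
    simp only [hmem]
    by_cases hcW : c ∈ W <;> simp [hcW]

/-- **The coefficient identity.** For `Γ : Option (Fin h) → Fin h → ℂ` and `U, W ⊆ Fin h`,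
`coeff_{x^U y^W} (G_none · ∏_a (1 + x_a G_{some a})) = ∏_{c∈W} (Γ none c + Σ_{a∈U} Γ (some a) c)`,
where `G_o = ∏_c (1 + Γ o c · y_c)`. -/
theorem coeff_partition_subsetSumF (Γ : Option (Fin h) → Fin h → ℂ) (U W : Finset (Fin h)) :
    coeff (∑ a ∈ U, Finsupp.single (Fin.castAdd h a) 1 + ∑ c ∈ W, Finsupp.single (Fin.natAdd h c) 1)
      ((∏ c : Fin h, (1 + C (Γ none c) * X (Fin.natAdd h c))) *
        ∏ a : Fin h, (1 + X (Fin.castAdd h a) *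
          ∏ c : Fin h, (1 + C (Γ (some a) c) * X (Fin.natAdd h c))) : MvPolynomial (Fin (h + h)) ℂ) =
      ∏ c ∈ W, (Γ none c + ∑ a ∈ U, Γ (some a) c) := by
  classical
  -- Step 1: expand the product over `a` as a sum over `V ⊆ Fin h`
  rw [Finset.prod_one_add (f := fun a : Fin h => X (Fin.castAdd h a) *
    ∏ c : Fin h, (1 + C (Γ (some a) c) * X (Fin.natAdd h c))), Finset.mul_sum, coeff_sum]
  -- the `V`-term is `x^V · R_V` with `R_V = ∏_{p ∈ insertNone V ×ˢ univ} (1 + Γ p.1 p.2 · y_{p.2})`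
  have hterm : ∀ V : Finset (Fin h),
      ((∏ c : Fin h, (1 + C (Γ none c) * X (Fin.natAdd h c))) *
        ∏ a ∈ V, (X (Fin.castAdd h a) * ∏ c : Fin h, (1 + C (Γ (some a) c) * X (Fin.natAdd h c))) :
          MvPolynomial (Fin (h + h)) ℂ) =
      monomial (∑ a ∈ V, Finsupp.single (Fin.castAdd h a) 1 +
          ∑ c ∈ (∅ : Finset (Fin h)), Finsupp.single (Fin.natAdd h c) 1) 1 *
        ∏ p ∈ (Finset.insertNone V) ×ˢ (Finset.univ : Finset (Fin h)),
          (1 + C (Γ p.1 p.2) * X (Fin.natAdd h p.2)) := by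
    intro V
    rw [Finset.prod_mul_distrib, prod_X_castAdd_eq_monomial, Finset.prod_product,
      Finset.prod_insertNone]
    ring
  simp_rw [hterm, coeff_monomial_mul', one_mul]
  -- Step 2: only `V = U` survives
  rw [Finset.sum_eq_single U]
  · rw [if_pos ((partitionExpo_le_iff U U W).2 (subset_refl U)), partitionExpo_sub U U W (subset_refl U),
      Finset.sdiff_self, Finset.map_empty, Finset.empty_union, coeff_indicator_prod_one_add,
      Finset.prod_map]
    refine Finset.prod_congr rfl fun c _ => ?_
    -- the factors supplying `y_c` are exactly the pairs `(o, c)`, `o ∈ insertNone U`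
    have hfilter : ((Finset.insertNone U) ×ˢ (Finset.univ : Finset (Fin h))).filter
        (fun p : Option (Fin h) × Fin h => Fin.natAdd h p.2 = (Fin.natAddEmb h) c) =
        (Finset.insertNone U) ×ˢ {c} := by
      ext p
      simp only [Finset.mem_filter, Finset.mem_product, Finset.mem_univ, and_true,
        Finset.mem_singleton, Fin.natAddEmb_apply, Fin.natAdd_inj]
    rw [hfilter, Finset.sum_product, Finset.sum_insertNone]
    simp only [Finset.sum_singleton]
  · intro V _ hVU
    by_cases hsub : V ⊆ U
    · rw [if_pos ((partitionExpo_le_iff V U W).2 hsub), partitionExpo_sub V U W hsub,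
        coeff_indicator_prod_one_add]
      obtain ⟨a, haU, haV⟩ : ∃ a ∈ U, a ∉ V := Finset.not_subset.1 (fun hUV =>
        hVU (Finset.Subset.antisymm hsub hUV))
      apply Finset.prod_eq_zero (i := Fin.castAdd h a)
      · exact Finset.mem_union_left _ (Finset.mem_map_of_mem _ (Finset.mem_sdiff.2 ⟨haU, haV⟩))
      · apply Finset.sum_eq_zero
        intro p hp
        exact absurd (Finset.mem_filter.1 hp).2.symm (castAdd_ne_natAdd a p.2)
    · rw [if_neg (fun hle => hsub ((partitionExpo_le_iff V U W).1 hle))]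
  · intro hU
    exact absurd (Finset.mem_powerset.2 (Finset.subset_univ U)) hU

/-- The degree of the partition exponent `x^U y^W` is `#U + #W ≤ 2h`. -/
theorem degree_partitionExpo_le (U W : Finset (Fin h)) :
    ((∑ a ∈ U, Finsupp.single (Fin.castAdd h a) 1 +
        ∑ c ∈ W, Finsupp.single (Fin.natAdd h c) 1 : Fin (h + h) →₀ ℕ)).degree ≤ h + h := by
  rw [map_add, map_sum, map_sum]
  simp only [Finsupp.degree_single, Finset.sum_const, smul_eq_mul, mul_one]
  have hu : U.card ≤ h := by simpa using Finset.card_le_univ U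
  have hw : W.card ≤ h := by simpa using Finset.card_le_univ W
  omega

/-- **The coefficient identity for the truncated witness** `Σ_{e ≤ 2h} F_Γ^{(e)}`. -/
theorem coeff_partition_trunc_subsetSumF (Γ : Option (Fin h) → Fin h → ℂ) (U W : Finset (Fin h)) :
    coeff (∑ a ∈ U, Finsupp.single (Fin.castAdd h a) 1 + ∑ c ∈ W, Finsupp.single (Fin.natAdd h c) 1)
      (∑ e ∈ Finset.range (h + h + 1), homogeneousComponent e
        ((∏ c : Fin h, (1 + C (Γ none c) * X (Fin.natAdd h c))) *
          ∏ a : Fin h, (1 + X (Fin.castAdd h a) *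
            ∏ c : Fin h, (1 + C (Γ (some a) c) * X (Fin.natAdd h c))) : MvPolynomial (Fin (h + h)) ℂ)) =
      ∏ c ∈ W, (Γ none c + ∑ a ∈ U, Γ (some a) c) := by
  rw [Literature.Computability.AlgebraicComplexity.SahaThankey2021.Trunc.coeff_trunc,
    if_pos (degree_partitionExpo_le U W), coeff_partition_subsetSumF]

end

end Summit.ValiantsHypothesis.ValiantsHypothesis.Theorems.BarrierLever.SubsetSum
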